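import Summits.BirchSwinnertonDyer.BirchSwinnertonDyer.Theorems.ManinLocalTwoThreeNegOneTwistConductorAtTwo
import Literature.NumberTheory.EllipticCurves.OggFormulaTwistTameTwoProofs
import HarnessLib

/-!
# S-an-63 «16 ∥ N descends», row `II/4`: a curve of Kodaira type `II` at `2` with `ord₂ Δ_min = 4` (`f₂ = 4`) has `χ₋₄`-twist of
# type `III` (`f₂ = 3`) or `IV` (`f₂ = 2`) — Barrios et al. 2025 Thm. 5.1, row II (`v(a₃) = 1`), `d ≡ 3 (4)`, for `d = −1`
# (route `ManinLocalTwoThree`, crux C2 `ManinOddAtFour` stmt-BirchSwinnertonDyer-22967; cell bsd-f2-manin, an's candidate S-an-63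
# `SixteenExactDescends` / `conductorExponent_quadraticTwist_two_of_eq_four`; p2 g13 HANDOFF recipe, p3 gen 12)

First of the seven rows of the `f₂ = 4` list (`kodairaSymbolAt_of_conductorExponent_eq_four_two`, sibling
`…ConductorExponentFourAtTwo`).  §1 `ℤ₂` bookkeeping (`ϖᵏ ∣ x ↔ 2ᵏ ∣ x` for the tree's chosen uniformiser).  §2 the twist of the
`II/4` normal form `[2α, B, 2γ, 2q, 2r]` (`γ, r ∈ ℤ₂ˣ`; tree `LocalIndex.exists_smul_a_of_kodairaSymbolOfMinimal_eq_II_of_two_of_addVal_eq_four`)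
is `T = [0, −(α² + B), 0, 2(q + αγ), −(γ² + 2r)]`.  §3 Tate's algorithm on `T″ = (1, 0, 0, 1) • T` (singular point to `(0,0)`;
`a₃″ = 2`, `4 ∣ a₆″` as `γ² + 2r + 1 ∈ 4ℤ₂`, `b₈″ = 4M`, `M = (α² + B)(γ² + 2r) − (q + αγ)²`, `b₆″ = −4(γ² + 2r)`): type `III` if
`M ∈ ℤ₂ˣ`, type `IV` if `2 ∣ M`.  §4 the assembly (p2's `key` block from `…NegOneTwistConductorAtTwo` §4, verbatim in shape): Ogg on the
exit model with `ord₂ Δ = 4` unchanged gives `f₂(W ⊗ (−1)) = 3` or `2`, hence `≤ 3`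
(`conductorExponent_quadraticTwist_negOne_of_II_four`, `…_le_three_of_II_four`).  (`M mod 2 = B + q`, so `III` iff `b₈ ∈ 4ℤ₂ˣ`, `IV` iff
`8 ∣ b₈`, as in Barrios's table and in the tree's `OggFormulaTwistTameTwoProofs`, which treats the `8 ∣ b₈` branch on the Galois side;
not needed here.)

HONEST FRAMING: a local theorem in print, kernel-checked; one row of an E-blind bookkeeping law.  Nothing about BSD or Manin's
conjecture is proved; C2 OPEN. [cite: BarriosEtAl2025, Thm. 5.1 (arXiv:2501.03209 p. 15), row II, (f, f^d) ∈ {(4,3),(4,2)}]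
[cite: SilvermanATAEC1994, IV.9.4 Steps 1–5 and IV.11.1]
-/

set_option autoImplicit false
-- lint-debt: the directory name repeats the summit name (sibling precedent `ManinLocalTwoThreeNegOneTwistConductorAtTwo.lean`)
set_option linter.dupNamespace false

noncomputable section

open scoped Classical
open Polynomial IsLocalRing WeierstrassCurve
open IsDiscreteValuationRing hiding maximalIdeal
open Literature.NumberTheory.DiophantineGeometry Literature.NumberTheory.DiophantineGeometry.TateAlgorithm

namespace Summit.BirchSwinnertonDyer.BirchSwinnertonDyer.Theorems.ManinLocalTwoThree

/-! ## §1 `ℤ₂` bookkeeping: powers of the uniformiser versus powers of `2` -/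

/-- In `ℤ₂`, divisibility by `ϖᵏ` (the tree's chosen uniformiser) is divisibility by `2ᵏ`. [folklore] -/
theorem uniformizer_pow_dvd_iff_two_pow_dvd (k : ℕ) (x : ℤ_[2]) :
    uniformizer ℤ_[2] ^ k ∣ x ↔ (2 : ℤ_[2]) ^ k ∣ x := by
  obtain ⟨ε, hε, hpε⟩ := Literature.NumberTheory.EllipticCurves.TwistGoodTwo.exists_isUnit_two_eq_uniformizer_mul_padicInt
  rw [hpε, mul_pow]
  exact (IsUnit.mul_right_dvd (hε.pow k)).symm

/-- In `ℤ₂`, divisibility by `ϖ` is divisibility by `2`. [folklore] -/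
theorem uniformizer_dvd_iff_two_dvd (x : ℤ_[2]) : uniformizer ℤ_[2] ∣ x ↔ (2 : ℤ_[2]) ∣ x := by
  simpa using uniformizer_pow_dvd_iff_two_pow_dvd 1 x

/-! ## §2 The `χ₋₄`-twist of the type-`II`, `ord₂ Δ = 4` normal form -/

/-- Twist of the `II/4`-form `[2α, B, 2γ, 2q, 2r]`: `[0, −(α² + B), 0, 2(q + αγ), −(γ² + 2r)]`, read over `ℚ₂`.
[cite: SilvermanAEC2009, X.2 Prop. 2.4 (shape of the quadratic twist)] -/
theorem quadraticTwist_negOne_map_of_IIFourForm (N : WeierstrassCurve ℤ_[2]) {α γ q r : ℤ_[2]}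
    (h₁ : N.a₁ = 2 * α) (h₃ : N.a₃ = 2 * γ) (h₄ : N.a₄ = 2 * q) (h₆ : N.a₆ = 2 * r) :
    (N.map (algebraMap ℤ_[2] ℚ_[2])).quadraticTwist (-1) =
      (⟨0, -(α ^ 2 + N.a₂), 0, 2 * (q + α * γ), -(γ ^ 2 + 2 * r)⟩ : WeierstrassCurve ℤ_[2]).map
        (algebraMap ℤ_[2] ℚ_[2]) := by
  obtain ⟨a₁, a₂, a₃, a₄, a₆⟩ := N
  simp only at h₁ h₃ h₄ h₆
  subst h₁ h₃ h₄ h₆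
  have c2 : ((2 : ℤ_[2]) : ℚ_[2]) = 2 := map_ofNat PadicInt.Coe.ringHom 2
  ext <;> simp [WeierstrassCurve.quadraticTwist, WeierstrassCurve.map, WeierstrassCurve.b₂, WeierstrassCurve.b₄,
    WeierstrassCurve.b₆, c2] <;> ring

/-! ## §3 Tate's algorithm on the twisted model: type `III` or type `IV` -/

section Exit

variable (A Q γ r : ℤ_[2])

/-- Re-normalised twist `T″ = (1,0,0,1) • [0, −A, 0, 2Q, −(γ²+2r)]`: `a₁″ = 0`. [folklore] -/
private theorem twistII_a₁ : ((⟨1, 0, 0, 1⟩ : VariableChange ℤ_[2]) • (⟨0, -A, 0, 2 * Q, -(γ ^ 2 + 2 * r)⟩ : WeierstrassCurve ℤ_[2])).a₁ = 0 := by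
  rw [variableChange_a₁]; simp
/-- Re-normalised twist `T″ = (1,0,0,1) • [0, −A, 0, 2Q, −(γ²+2r)]`: `a₂″ = −A`. [folklore] -/
private theorem twistII_a₂ : ((⟨1, 0, 0, 1⟩ : VariableChange ℤ_[2]) • (⟨0, -A, 0, 2 * Q, -(γ ^ 2 + 2 * r)⟩ : WeierstrassCurve ℤ_[2])).a₂ = -A := by
  rw [variableChange_a₂]; simp
/-- Re-normalised twist `T″ = (1,0,0,1) • [0, −A, 0, 2Q, −(γ²+2r)]`: `a₃″ = 2`. [folklore] -/
private theorem twistII_a₃ : ((⟨1, 0, 0, 1⟩ : VariableChange ℤ_[2]) • (⟨0, -A, 0, 2 * Q, -(γ ^ 2 + 2 * r)⟩ : WeierstrassCurve ℤ_[2])).a₃ = 2 := by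
  rw [variableChange_a₃]; simp
/-- Re-normalised twist `T″ = (1,0,0,1) • [0, −A, 0, 2Q, −(γ²+2r)]`: `a₄″ = 2Q`. [folklore] -/
private theorem twistII_a₄ : ((⟨1, 0, 0, 1⟩ : VariableChange ℤ_[2]) • (⟨0, -A, 0, 2 * Q, -(γ ^ 2 + 2 * r)⟩ : WeierstrassCurve ℤ_[2])).a₄ = 2 * Q := by
  rw [variableChange_a₄]; simp
/-- Re-normalised twist `T″ = (1,0,0,1) • [0, −A, 0, 2Q, −(γ²+2r)]`: `a₆″ = −(γ² + 2r) − 1`. [folklore] -/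
private theorem twistII_a₆ : ((⟨1, 0, 0, 1⟩ : VariableChange ℤ_[2]) • (⟨0, -A, 0, 2 * Q, -(γ ^ 2 + 2 * r)⟩ : WeierstrassCurve ℤ_[2])).a₆ = -(γ ^ 2 + 2 * r) - 1 := by
  rw [variableChange_a₆]; simp
/-- Re-normalised twist `T″ = (1,0,0,1) • [0, −A, 0, 2Q, −(γ²+2r)]`: `b₂″ = −4A`. [folklore] -/
private theorem twistII_b₂ : ((⟨1, 0, 0, 1⟩ : VariableChange ℤ_[2]) • (⟨0, -A, 0, 2 * Q, -(γ ^ 2 + 2 * r)⟩ : WeierstrassCurve ℤ_[2])).b₂ = 2 * (-(2 * A)) := by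
  rw [WeierstrassCurve.b₂, twistII_a₁, twistII_a₂]; ring
/-- Re-normalised twist `T″ = (1,0,0,1) • [0, −A, 0, 2Q, −(γ²+2r)]`: `b₄″ = 4Q`. [folklore] -/
private theorem twistII_b₄ : ((⟨1, 0, 0, 1⟩ : VariableChange ℤ_[2]) • (⟨0, -A, 0, 2 * Q, -(γ ^ 2 + 2 * r)⟩ : WeierstrassCurve ℤ_[2])).b₄ = 2 * (2 * Q) := by
  rw [WeierstrassCurve.b₄, twistII_a₁, twistII_a₃, twistII_a₄]; ring
/-- Re-normalised twist `T″ = (1,0,0,1) • [0, −A, 0, 2Q, −(γ²+2r)]`: `b₆″ = −4(γ² + 2r)`. [folklore] -/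
private theorem twistII_b₆ : ((⟨1, 0, 0, 1⟩ : VariableChange ℤ_[2]) • (⟨0, -A, 0, 2 * Q, -(γ ^ 2 + 2 * r)⟩ : WeierstrassCurve ℤ_[2])).b₆ = 2 ^ 2 * (-(γ ^ 2 + 2 * r)) := by
  rw [WeierstrassCurve.b₆, twistII_a₃, twistII_a₆]; ring
/-- Re-normalised twist `T″ = (1,0,0,1) • [0, −A, 0, 2Q, −(γ²+2r)]`: `b₈″ = 4(A(γ² + 2r) − Q²)`. [folklore] -/
private theorem twistII_b₈ : ((⟨1, 0, 0, 1⟩ : VariableChange ℤ_[2]) • (⟨0, -A, 0, 2 * Q, -(γ ^ 2 + 2 * r)⟩ : WeierstrassCurve ℤ_[2])).b₈ = 2 ^ 2 * (A * (γ ^ 2 + 2 * r) - Q ^ 2) := by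
  rw [WeierstrassCurve.b₈, twistII_a₁, twistII_a₂, twistII_a₃, twistII_a₄, twistII_a₆]; ring

variable {A Q γ r}

/-- With `γ = 1 + 2κ` and `r = 1 + 2ρ`: `a₆″ = −4(1 + κ + κ² + ρ)`. [folklore] -/
private theorem twistII_a₆_eq {κ ρ : ℤ_[2]} (hγ : γ = 1 + 2 * κ) (hr : r = 1 + 2 * ρ) :
    ((⟨1, 0, 0, 1⟩ : VariableChange ℤ_[2]) • (⟨0, -A, 0, 2 * Q, -(γ ^ 2 + 2 * r)⟩ : WeierstrassCurve ℤ_[2])).a₆ = 2 ^ 2 * (-(1 + κ + κ ^ 2 + ρ)) := by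
  rw [twistII_a₆, hγ, hr]; ring

/-- The common Step-2 data of `T″`: `2 ∣ Δ, a₃, a₄, a₆, b₂` and `4 ∣ a₆`, in terms of the uniformiser. [cite: SilvermanATAEC1994, IV.9.4 Steps 1–3] -/
private theorem twistII_step2 {κ ρ : ℤ_[2]} (hγ : γ = 1 + 2 * κ) (hr : r = 1 + 2 * ρ) :
    uniformizer ℤ_[2] ∣ ((⟨1, 0, 0, 1⟩ : VariableChange ℤ_[2]) • (⟨0, -A, 0, 2 * Q, -(γ ^ 2 + 2 * r)⟩ : WeierstrassCurve ℤ_[2])).Δ ∧ uniformizer ℤ_[2] ∣ ((⟨1, 0, 0, 1⟩ : VariableChange ℤ_[2]) • (⟨0, -A, 0, 2 * Q, -(γ ^ 2 + 2 * r)⟩ : WeierstrassCurve ℤ_[2])).a₃ ∧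
      uniformizer ℤ_[2] ∣ ((⟨1, 0, 0, 1⟩ : VariableChange ℤ_[2]) • (⟨0, -A, 0, 2 * Q, -(γ ^ 2 + 2 * r)⟩ : WeierstrassCurve ℤ_[2])).a₄ ∧ uniformizer ℤ_[2] ∣ ((⟨1, 0, 0, 1⟩ : VariableChange ℤ_[2]) • (⟨0, -A, 0, 2 * Q, -(γ ^ 2 + 2 * r)⟩ : WeierstrassCurve ℤ_[2])).a₆ ∧
      uniformizer ℤ_[2] ∣ ((⟨1, 0, 0, 1⟩ : VariableChange ℤ_[2]) • (⟨0, -A, 0, 2 * Q, -(γ ^ 2 + 2 * r)⟩ : WeierstrassCurve ℤ_[2])).b₂ ∧ uniformizer ℤ_[2] ^ 2 ∣ ((⟨1, 0, 0, 1⟩ : VariableChange ℤ_[2]) • (⟨0, -A, 0, 2 * Q, -(γ ^ 2 + 2 * r)⟩ : WeierstrassCurve ℤ_[2])).a₆ := by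
  simp only [uniformizer_dvd_iff_two_dvd, uniformizer_pow_dvd_iff_two_pow_dvd]
  refine ⟨?_, ?_, ?_, ?_, ?_, ?_⟩
  · refine dvd_Δ_of_dvd_b ?_ ?_ ?_ ?_
    · rw [twistII_b₂]; exact dvd_mul_right _ _
    · rw [twistII_b₄]; exact dvd_mul_right _ _
    · rw [twistII_b₆]; exact (dvd_pow_self 2 two_ne_zero).trans (dvd_mul_right _ _)
    · rw [twistII_b₈]; exact (dvd_pow_self 2 two_ne_zero).trans (dvd_mul_right _ _)
  · rw [twistII_a₃]
  · rw [twistII_a₄]; exact dvd_mul_right _ _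
  · rw [twistII_a₆_eq hγ hr]; exact (dvd_pow_self 2 two_ne_zero).trans (dvd_mul_right _ _)
  · rw [twistII_b₂]; exact dvd_mul_right _ _
  · rw [twistII_a₆_eq hγ hr]; exact dvd_mul_right _ _

/-- **The twist of the `II/4`-form is of type `III` when `M = (α² + B)(γ² + 2r) − (q + αγ)²` is a unit** (`8 ∤ b₈″ = 4M`).
[cite: SilvermanATAEC1994, IV.9.4 Steps 1–4] -/
theorem kodairaSymbolOfMinimal_negTwist_IIFour_III {κ ρ : ℤ_[2]} (hγ : γ = 1 + 2 * κ) (hr : r = 1 + 2 * ρ)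
    (hM : IsUnit (A * (γ ^ 2 + 2 * r) - Q ^ 2)) :
    ((⟨1, 0, 0, 1⟩ : VariableChange ℤ_[2]) •
        (⟨0, -A, 0, 2 * Q, -(γ ^ 2 + 2 * r)⟩ : WeierstrassCurve ℤ_[2])).kodairaSymbolOfMinimal = .III := by
  have hirr : Irreducible (2 : ℤ_[2]) := by exact_mod_cast PadicInt.irreducible_p (p := 2)
  obtain ⟨hΔ, n3, n4, n6, hb₂, ha₆⟩ := twistII_step2 (A := A) (Q := Q) hγ hr
  refine kodairaSymbolOfMinimal_eq_III_of_step2 hΔ n3 n4 n6 hb₂ ha₆ ?_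
  rw [uniformizer_pow_dvd_iff_two_pow_dvd, twistII_b₈, show (2 : ℤ_[2]) ^ 3 = 2 ^ 2 * 2 by norm_num]
  intro h
  have h' : (2 : ℤ_[2]) ∣ A * (γ ^ 2 + 2 * r) - Q ^ 2 := (mul_dvd_mul_iff_left (by norm_num)).mp h
  exact (isUnit_iff_not_dvd hirr _).mp hM h'

/-- **The twist of the `II/4`-form is of type `IV` when `2 ∣ M`** (`8 ∣ b₈″`, and `b₆″ = −4(γ² + 2r)` with `γ² + 2r` a unit).
[cite: SilvermanATAEC1994, IV.9.4 Steps 1–5] -/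
theorem kodairaSymbolOfMinimal_negTwist_IIFour_IV {κ ρ : ℤ_[2]} (hγ : γ = 1 + 2 * κ) (hr : r = 1 + 2 * ρ)
    (hM : (2 : ℤ_[2]) ∣ A * (γ ^ 2 + 2 * r) - Q ^ 2) :
    ((⟨1, 0, 0, 1⟩ : VariableChange ℤ_[2]) •
        (⟨0, -A, 0, 2 * Q, -(γ ^ 2 + 2 * r)⟩ : WeierstrassCurve ℤ_[2])).kodairaSymbolOfMinimal = .IV := by
  have hirr : Irreducible (2 : ℤ_[2]) := by exact_mod_cast PadicInt.irreducible_p (p := 2)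
  obtain ⟨hΔ, n3, n4, n6, hb₂, ha₆⟩ := twistII_step2 (A := A) (Q := Q) hγ hr
  refine kodairaSymbolOfMinimal_eq_IV_of_step2 hΔ n3 n4 n6 hb₂ ha₆ ?_ ?_
  · rw [uniformizer_pow_dvd_iff_two_pow_dvd, twistII_b₈, show (2 : ℤ_[2]) ^ 3 = 2 ^ 2 * 2 by norm_num]
    exact mul_dvd_mul_left _ hM
  · rw [uniformizer_pow_dvd_iff_two_pow_dvd, twistII_b₆, show (2 : ℤ_[2]) ^ 3 = 2 ^ 2 * 2 by norm_num]
    intro h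
    have h' : (2 : ℤ_[2]) ∣ -(γ ^ 2 + 2 * r) := (mul_dvd_mul_iff_left (by norm_num)).mp h
    have hu : IsUnit (γ ^ 2 + 2 * r) := by
      rw [hγ, show ((1 + 2 * κ) ^ 2 + 2 * r : ℤ_[2]) = 1 + 2 * (2 * κ + 2 * κ ^ 2 + r) by ring]
      exact isUnit_one_add_two_mul_padicInt _
    exact (isUnit_iff_not_dvd hirr _).mp hu (dvd_neg.mp h')

end Exit

/-! ## §4 The global assembly: `II` with `ord₂ Δ_min = 4` twists to `f₂ ≤ 3` -/

/-- **S-an-63, row `II/4`** (Barrios et al. 2025 Thm. 5.1, row II with `v(a₃) = 1`, `d ≡ 3 (4)`, kernel-checked for `d = −1`): if `W/ℚ`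
is of Kodaira type `II` at `2` with `ord₂ Δ_min = 4` (the `f₂ = 4` stratum of type `II`), then `f₂(W ⊗ (−1)) = 3` (type `III`) or
`f₂(W ⊗ (−1)) = 2` (type `IV`); in particular `f₂(W ⊗ (−1)) ≤ 3`.  Normal form `LocalIndex.exists_smul_a_of_kodairaSymbolOfMinimal_eq_II_of_two_of_addVal_eq_four`
(`a₃/2`, `a₆/2` units), twist `[0, −(α²+a₂), 0, 2(q+αγ), −(γ²+2r)]`, re-normalisation `(1,0,0,1)`, exits §3, Ogg's formula on the exit model
(`conductorExponent_negTwist_of_exitModel`) with `ord₂ Δ` unchanged (`= 4`).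
[cite: BarriosEtAl2025, Thm. 5.1 (arXiv:2501.03209 p. 15), row II, column (f, f^d) ∈ {(4,3), (4,2)}] [cite: SilvermanATAEC1994, IV.9.4 and IV.11.1] -/
theorem conductorExponent_quadraticTwist_negOne_of_II_four (W : WeierstrassCurve ℚ) [W.IsElliptic]
    (hK : W.kodairaSymbolAt ((Rat.HeightOneSpectrum.primesEquiv (R := ℤ)).symm ⟨2, Nat.prime_two⟩) = .II)
    (hord : W.ordMinimalDiscriminant ((Rat.HeightOneSpectrum.primesEquiv (R := ℤ)).symm ⟨2, Nat.prime_two⟩) = 4) :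
    (W.quadraticTwist ((-1 : ℤ) : ℚ)).conductorExponent ((Rat.HeightOneSpectrum.primesEquiv (R := ℤ)).symm ⟨2, Nat.prime_two⟩) = 3 ∨
    (W.quadraticTwist ((-1 : ℤ) : ℚ)).conductorExponent ((Rat.HeightOneSpectrum.primesEquiv (R := ℤ)).symm ⟨2, Nat.prime_two⟩) = 2 := by
  haveI : Fact (Nat.Prime 2) := ⟨Nat.prime_two⟩
  haveI : Finite (ResidueField ℤ_[2]) := Finite.of_equiv _ (PadicInt.residueField (p := 2)).toEquiv.symm
  have hirr : Irreducible (2 : ℤ_[2]) := by exact_mod_cast PadicInt.irreducible_p (p := 2)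
  set v : IsDedekindDomain.HeightOneSpectrum ℤ := (Rat.HeightOneSpectrum.primesEquiv (R := ℤ)).symm ⟨2, Nat.prime_two⟩
    with hvdef
  have e : Rat.HeightOneSpectrum.primesEquiv (R := ℤ) v = ⟨2, Nat.prime_two⟩ := Equiv.apply_symm_apply _ _
  -- Kodaira `II` and `ord Δ_min = 4`, read over `ℤ₂`
  have hKp := WeierstrassCurve.kodairaSymbolAt_eq_padic (R := ℤ) v W
  rw [e] at hKp
  change W.kodairaSymbolAt v = (((W.baseChange ℚ_[2]).minimal ℤ_[2]).integralModel ℤ_[2]).kodairaSymbolOfMinimal at hKp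
  have hOp := WeierstrassCurve.ordMinimalDiscriminant_eq_padic (R := ℤ) v W
  rw [e] at hOp
  change W.ordMinimalDiscriminant v =
    (IsDiscreteValuationRing.addVal ℤ_[2] (((W.baseChange ℚ_[2]).minimal ℤ_[2]).integralModel ℤ_[2]).Δ).toNat at hOp
  set X : WeierstrassCurve ℚ_[2] := W.baseChange ℚ_[2] with hX
  set V₀ : WeierstrassCurve ℤ_[2] := (X.minimal ℤ_[2]).integralModel ℤ_[2] with hV₀
  set E : VariableChange ℚ_[2] := (X.exists_isMinimal ℤ_[2]).choose with hE
  have hmin : X.minimal ℤ_[2] = E • X := rfl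
  have hV₀X : V₀.baseChange ℚ_[2] = X.minimal ℤ_[2] := WeierstrassCurve.baseChange_integralModel_eq ℤ_[2] _
  rw [hK] at hKp
  rw [hord] at hOp
  -- the twist over `ℚ₂`
  have hd0 : ((-1 : ℤ) : ℚ) ≠ 0 := by norm_num
  haveI := W.isElliptic_quadraticTwist hd0
  set Xm : WeierstrassCurve ℚ_[2] := (W.quadraticTwist ((-1 : ℤ) : ℚ)).baseChange ℚ_[2] with hXm
  have hXmX : Xm = X.quadraticTwist (-1) := by
    rw [hXm, hX, WeierstrassCurve.baseChange, WeierstrassCurve.baseChange, WeierstrassCurve.map_quadraticTwist]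
    simp
  -- common step (p2's `key`): from a normal form `N = D • V₀` and a twist model `T` to the exit model `C₆ • T`
  have key : ∀ (D : VariableChange ℤ_[2]) (T : WeierstrassCurve ℤ_[2]) (C₆ : VariableChange ℤ_[2]),
      ((D • V₀).map (algebraMap ℤ_[2] ℚ_[2])).quadraticTwist (-1) = T.map (algebraMap ℤ_[2] ℚ_[2]) →
      (C₆ • T).kodairaSymbolOfMinimal ≠ .I 0 →
      (W.quadraticTwist ((-1 : ℤ) : ℚ)).conductorExponent v =
        (IsDiscreteValuationRing.addVal ℤ_[2] V₀.Δ).toNat + 1 - (C₆ • T).kodairaSymbolOfMinimal.numComponents := by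
    intro D T C₆ hNT hne
    set Ctot : VariableChange ℚ_[2] := D.map (algebraMap ℤ_[2] ℚ_[2]) * E with hCtot
    have hCX : Ctot • X = (D • V₀).map (algebraMap ℤ_[2] ℚ_[2]) := by
      rw [hCtot, mul_smul, ← hmin, ← hV₀X]
      exact WeierstrassCurve.map_variableChange _ _ _
    set C₁ : VariableChange ℚ_[2] := ⟨Ctot.u, (-1) * Ctot.r, 0, 0⟩ with hC₁
    have hT : T.map (algebraMap ℤ_[2] ℚ_[2]) = C₁ • Xm := by
      rw [← hNT, ← hCX, WeierstrassCurve.quadraticTwist_smul, hXmX]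
    have hT' : (C₆ • T).map (algebraMap ℤ_[2] ℚ_[2]) = (C₆.map (algebraMap ℤ_[2] ℚ_[2]) * C₁) • Xm := by
      rw [mul_smul, ← hT]
      exact (WeierstrassCurve.map_variableChange _ _ _).symm
    rw [conductorExponent_negTwist_of_exitModel W (C₆ • T) _ hT' hne, addVal_Δ_smul_toNat]
    have hΔT : (T.Δ : ℚ_[2]) = ((D • V₀).Δ : ℚ_[2]) := by
      have h1 : (T.map (algebraMap ℤ_[2] ℚ_[2])).Δ = (((D • V₀).map (algebraMap ℤ_[2] ℚ_[2])).quadraticTwist (-1)).Δ := by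
        rw [hNT]
      rw [WeierstrassCurve.map_Δ, WeierstrassCurve.quadraticTwist_Δ, WeierstrassCurve.map_Δ] at h1
      norm_num at h1
      exact h1
    have hΔT' : T.Δ = (D • V₀).Δ := IsFractionRing.injective ℤ_[2] ℚ_[2] hΔT
    rw [hΔT', addVal_Δ_smul_toNat]
  -- the `II/4` normal form with unit witnesses
  obtain ⟨D, ⟨α, hα⟩, ⟨γ, hγu, hγ⟩, ⟨q, hq⟩, ⟨r, hru, hr⟩, -, -⟩ :=
    Literature.NumberTheory.EllipticCurves.LocalIndex.exists_smul_a_of_kodairaSymbolOfMinimal_eq_II_of_two_of_addVal_eq_four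
      hirr V₀ hKp.symm hOp.symm
  obtain ⟨κ, hκ⟩ := exists_eq_one_add_two_mul_of_isUnit_padicInt hγu
  obtain ⟨ρ, hρ⟩ := exists_eq_one_add_two_mul_of_isUnit_padicInt hru
  have hNT := quadraticTwist_negOne_map_of_IIFourForm (D • V₀) hα hγ hq hr
  by_cases hM : IsUnit ((α ^ 2 + (D • V₀).a₂) * (γ ^ 2 + 2 * r) - (q + α * γ) ^ 2)
  · -- type III: `f = 4 + 1 − 2 = 3`
    have hexit := kodairaSymbolOfMinimal_negTwist_IIFour_III (A := α ^ 2 + (D • V₀).a₂) (Q := q + α * γ) hκ hρ hM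
    left
    rw [key D _ ⟨1, 0, 0, 1⟩ hNT (by rw [hexit]; decide), hexit, ← hOp]
    rfl
  · -- type IV: `f = 4 + 1 − 3 = 2`
    have hM' : (2 : ℤ_[2]) ∣ (α ^ 2 + (D • V₀).a₂) * (γ ^ 2 + 2 * r) - (q + α * γ) ^ 2 :=
      (not_isUnit_iff_dvd hirr _).mp hM
    have hexit := kodairaSymbolOfMinimal_negTwist_IIFour_IV (A := α ^ 2 + (D • V₀).a₂) (Q := q + α * γ) hκ hρ hM'
    right
    rw [key D _ ⟨1, 0, 0, 1⟩ hNT (by rw [hexit]; decide), hexit, ← hOp]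
    rfl

/-- **S-an-63, row `II/4`, in the `≤ 3` form.** [cite: BarriosEtAl2025, Thm. 5.1 (arXiv:2501.03209 p. 15), row II] -/
theorem conductorExponent_quadraticTwist_negOne_le_three_of_II_four (W : WeierstrassCurve ℚ) [W.IsElliptic]
    (hK : W.kodairaSymbolAt ((Rat.HeightOneSpectrum.primesEquiv (R := ℤ)).symm ⟨2, Nat.prime_two⟩) = .II)
    (hord : W.ordMinimalDiscriminant ((Rat.HeightOneSpectrum.primesEquiv (R := ℤ)).symm ⟨2, Nat.prime_two⟩) = 4) :
    (W.quadraticTwist ((-1 : ℤ) : ℚ)).conductorExponent ((Rat.HeightOneSpectrum.primesEquiv (R := ℤ)).symm ⟨2, Nat.prime_two⟩) ≤ 3 := by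
  rcases conductorExponent_quadraticTwist_negOne_of_II_four W hK hord with h | h <;> omega

end Summit.BirchSwinnertonDyer.BirchSwinnertonDyer.Theorems.ManinLocalTwoThree

end
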